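import Summits.QuantumFields.YangMills.Theorems.BalabanUVNodesN11TStepGraphIntegrableOfProvisos
import Summits.QuantumFields.YangMills.Theorems.BalabanUVNodesN11TStepOldBranchInnerSum
import Summits.QuantumFields.YangMills.Theorems.BalabanUVNodesN11TStepOldBranchGraphIntegrable
import Summits.QuantumFields.YangMills.Theorems.BalabanUVNodesN21StepWeightsPositivity
import Literature.MathematicalPhysics.QuantumFieldTheory.Balaban1983to89.B14SeparationOfRecord

/-!
# DAG node N11 — THE OLD-BRANCH (O3′) THEOREM WITHOUT ITS INTEGRABILITY ROWS: generic letters `_of_laws` (dag-n11-d's `…TStepOldBranchInnerSum` ★★★★★★ with `hint` ↦ `hgm` +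
# weight laws + nonnegative operand), Stage-13 letters `_of_provisos` (dag-n11-d's `…OldBranchInnerSumAtRecord13` §2 with `hint` GONE and `hG₀` DISCHARGED from `θ.Provisos₁₃CoPH`)

HEADER — WORK-UNIT METADATA.  Cell `pub-ymgap`, YM-PLAN Track A (HUMAN RULING D-0062 ∕ D-0149), width seat `pub-ymgap-dag-n11-w2` (g4; WIDTH SEAT 2∕4 on N11 [B14]),
route `BalabanUVNodes`; this seat's jail key is K1⁷ `stmt-QuantumFields-20542` (`--kind proof --supports 20542 --as helper`, count-neutral); the K1 face of record since
KEY MAP v2 is K1⁹ `StabilityBRunRowsAtRecordR13SepCoPHV` = stmt-QuantumFields-27364 (MIS-KEY ∕ VALID rule R463 (4)(a): lineage BY NAME).  [III] = [Balaban1988Convergent].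
Sequel of this seat's p624357 `…TStepInnerIntegrandGraphIntegrable` (§3 `_of_laws` bottom), p626903 `…TStepBranchSumAtRecord13OfLaws` (§2 `hgm_at_record₁₃_of_rows`) and
`…TStepGraphIntegrableOfProvisos` (§2 `hG_at_record₁₃_of_provisos`), over dag-n11-d g15's p623644 `…TStepOldBranchInnerSum` (the three old-branch producers
`graph_ae_eq_sum_oldBranch_pieces` ∕ `innerReading_of_oldBranch_pieces` ∕ `innerSum_of_oldBranch_identifications`, and ★★★★★★ `slotsTOfRecord_succ_ae_eq_TkOfRecord_succ_of_oldBranchInnerSum`),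
p625485 `…TStepOldBranchGraphIntegrable` (§3 `integrable_oldBranch_pieces₁₃H_of_integrable_graph`), dag-n21-d's `…N21StepWeightsPositivity` (`zetaOfRecord_nonneg`), def-T's
`Node00/Record9InhabitedSU1` (`wOfRecord_nonneg`), `Node00/Record12Measurability` (`measurable_chiSeqOfRecord_of_localBg`), node00-def-K0c's `Node00/Record12MeasurabilityAbsolute`
(`localBgMeasurable`), `Node00/Record13CoPH` (`Stage13HParams.Provisos₁₃CoPH.tstep`, `.zhLaws`, `.zetaUnity`, `.zetaAbs`, `WtOfRecord₁₃H_laws`), `Node00/Sect2FormOfRecord`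
(`sect2Operand_pos`) and dag-n11-e's `B14SeparationOfRecord` (`slotsTOfRecord_succ_eq_zero_of_init_eq_zero`).  Bus: CLAIM-3 of g4.

WHY THIS FILE.  dag-n11-d's old-branch road (`N11-O3-ROAD.md`) closes the (O3′) clause of `PresentChildObligations` from Theorem 1's level-`k` form `hform`, per-old-branch graph
integrability `hG₀`, per-old-branch inner readings `hin₀`, the conditional-integrability row `hint`, and THE PER-OLD-BRANCH CHARTED IDENTIFICATIONS `hinner₀` (the mathematics).  Of these,
`hint` and `hG₀` are bookkeeping: `hint` is redundant under positivity (p624357), the joint measurability it leaves (`hgm`) follows from residual-measurability rows and the operand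
row (p626903 §2), and `hG₀` follows (p625485 §3) from def-T's `hG` — itself a theorem of the core provisos (`…TStepGraphIntegrableOfProvisos` §2) — plus `zhLaws`, `0 ≤ w`
(`zetaUnity` ∕ `zetaAbs`), measurability of `w`'s graph section (`Provisos₁₃CoPH.tstep.measW` read on the graph) and of `χ_k` (K0c's (H-U) theorem).  THIS FILE re-bills the old-branch
theorem accordingly: in the generic letters with `hint` ↦ `hgm` + `W.Laws` + nonnegative operand (§1), and in the Stage-13 letters with `hint` GONE and `hG₀` DISCHARGED (§2) — the
(O3′) DISJUNCTION of `PresentChildObligations` at a 𝐓-present child, for ANY `(t′, E′)`, from `θ.Provisos₁₃CoPH`, `hform`, four residual-measurability rows (residuals serving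
`init s′` and `s′`), two operand rows (old and new operand), and the chart-side data `Fᵢ₀` ∕ `hFm₀` ∕ `hin₀` ∕ `hinner₀` ONLY.

WHAT THIS FILE PROVES (0 `sorry`, 0 `def`, standard axioms).
§1 ★★★★★★ `slotsTOfRecord_succ_ae_eq_TkOfRecord_succ_of_oldBranchInnerSum_of_laws` (generic letters `V`, `W₀`, `W`, `Φ₀`, `Φ`: dag-n11-d's ★★★★★★ with `hint` REPLACED by `hgm` +
`hW : W.Laws` + `hΦ0`; the three old-branch producers of p623644 fed into p624357 §3).
§2 ★★★★★★ `slotsTOfRecord₁₃H_succ_O3_of_hasSect2FormAtZS_of_oldBranchInnerSum_of_provisos` (Stage-13 letters: dag-n11-d's `…OldBranchInnerSumAtRecord13` §2 with `hint` GONE and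
`hG₀` DISCHARGED; inputs `h : θ.Provisos₁₃CoPH F N`, `hform : HasSect2FormAtZS … k …` (ANY law package; dag-n11-e's `ChainFormAt θ p σ k` is this), the rows `hζ0m` ∕ `hqm` ∕ `hΦ₀m`
(residual serving `init s′`, old operand) and `hζm` ∕ `hqm'` ∕ `hΦm` (residual serving `s′`, new operand), and `Fᵢ₀` ∕ `hFm₀` ∕ `hin₀` ∕ `hinner₀`).

HONEST FRAMING.  Helper lane, count-neutral; compositions BY NAME (nothing of dag-n11-d's ∕ def-T's ∕ this seat's earlier files re-typed); every chart-side hypothesis (`hin₀`,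
`hinner₀`) and the level-`k` form DISPLAYED — `hinner₀` is where [I] §2's change of variables, its Jacobian, the gauge fixing, `ζ` and [III] Thm 2 live, NOT proved here; NO chart of
Bałaban's, NO Jacobian, NO Gaussian integration asserted; (B4) ∕ (S-α) ∕ (O3′) NOT closed; N11 NOT discharged; K1⁹ NOT closed, no registered stub touched; counts unmoved (typed 28∕28 ·
discharged 5∕27 · A 5∕28).  One finite `𝕋⁴_{L^K}` programme at fixed `ε = L^{−K}`; R4 closes only the conditional finite-𝕋⁴ rung `BalabanLadder.UV` — NOT ℝ⁴, NOT OS, NOT a mass gap,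
NOT Clay.  No `sorry`, `axiom`, `def`, `instance`, `notation`.  Sources (SHAPE ∕ bookkeeping only): [III] (2.1) p.254, (2.18) p.257, (2.20)–(2.21) p.258, (3.1) p.264, (3.2)–(3.9)
pp.265–266, (3.16) p.268, (3.24)–(3.25) p.270, §3 p.279, Thm 1 p.262, Thm 2 p.263.
-/

noncomputable section

open MeasureTheory ProbabilityTheory
open scoped ENNReal NNReal BigOperators Matrix.Norms.L2Operator

namespace Summit.QuantumFields.YangMills.Theorems.BalabanUVNodesN11TStepOldBranchInnerSumOfProvisos

open Literature.MathematicalPhysics.QuantumFieldTheory.Balaban1983to89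
open Literature.MathematicalPhysics.QuantumFieldTheory.Balaban1983to89.T4AveragingDisintegration
open BalabanUVNodesN11TStepOldBranchInnerSum (graph_ae_eq_sum_oldBranch_pieces innerReading_of_oldBranch_pieces innerSum_of_oldBranch_identifications)
open BalabanUVNodesN11TStepInnerIntegrandGraphIntegrable (slotsTOfRecord_succ_ae_eq_TkOfRecord_succ_of_innerSum_of_laws)
open BalabanUVNodesN11TStepBranchSumAtRecord13OfLaws (hgm_at_record₁₃_of_rows)
open BalabanUVNodesN11TStepGraphIntegrableOfProvisos (hG_at_record₁₃_of_provisos)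
open BalabanUVNodesN11TStepOldBranchGraphIntegrable (integrable_oldBranch_pieces₁₃H_of_integrable_graph)
open N21StepWeightsPositivity (zetaOfRecord_nonneg)
open Literature.MathematicalPhysics.QuantumFieldTheory.Balaban1983to89.B14SeparationOfRecord (slotsTOfRecord_succ_eq_zero_of_init_eq_zero)
open Node00 hiding SU
open Node00.Tk T4Continuum B14.Eq218Concrete
open B10Eq42TorusConstraint (bondsIn)

variable {F : T4Family} {N : ℕ} [NeZero N]

/-! ## §1  Generic letters: the old-branch theorem `_of_laws` (no conditional-integrability row) -/

section Generic

variable {V : Type} [NormedAddCommGroup V] [InnerProductSpace ℝ V] [FiniteDimensional ℝ V] [MeasurableSpace V] [BorelSpace V]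

/-- ★★★★★★ **(O3′) ON THE NOSE FROM THE OLD-BRANCH DATA, `_of_laws`**: dag-n11-d's `…TStepOldBranchInnerSum.slotsTOfRecord_succ_ae_eq_TkOfRecord_succ_of_oldBranchInnerSum` (p623644)
with p619836's conditional-integrability row `hint` REPLACED by joint measurability `hgm` of the explicit NEW inside integrands, 11a's weight laws `hW : W.Laws` of the NEW weights and a
NONNEGATIVE new operand `hΦ0`.  Inputs otherwise unchanged and DISPLAYED: (form) the `dU`-a.e. level-`k` identity on the `χ_k`-support, (hG₀) per-old-branch graph integrability, (hin₀) per-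
old-branch measurable inner readings `Fᵢ₀ S₀`, (hinner₀) THE PER-OLD-BRANCH CHARTED IDENTIFICATIONS.  Proof: p623644's three producers fed into this seat's p624357 §3.
[cite: Balaban1988Convergent, (2.1) p.254, (2.18) p.257, (2.20)–(2.21) p.258, (3.1) p.264, (3.24)–(3.25) p.270, §3 p.279, Thm 2 p.263] -/
theorem slotsTOfRecord_succ_ae_eq_TkOfRecord_succ_of_oldBranchInnerSum_of_laws (ν : Stage7Numerics) (τ : TowerNumerics) (E : B12.RunParams → ℝ)
    (w : StepWeightsOfRecord F N ν τ.M) (ppSel : PpSelOfRecord F ν τ.M) (p : B12.RunParams) (g : ℕ → ℝ) {k : ℕ} (hkK : k < p.K)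
    {hdec : DecidableEq (PBond (F.P p.K) k)} {hdec' : DecidableEq (PBond (F.P p.K) (k + 1))} (hk : k + 1 ≤ (F.P p.K).m + (F.P p.K).K)
    (s' : SeqOfRecord F ν τ.M g p.K (k + 1)) (W₀ W : TkWeights F N V p.K)
    (Φ₀ Φ : SFluct (F.P p.K) V → B15DeterminingSets.MSField (F.P p.K) (SU N) → ℝ)
    (hform : ∀ᵐ U ∂fieldMeasure (F.P p.K) k (SU N), chiSeqOfRecord F N ν τ.M g p.K k s'.init U ≠ 0 →
      slotsOfRecord F N ν τ E w ppSel p g k s'.init U = TkOfRecord F N V ν τ.M g p.K W₀ k s'.init Φ₀ U)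
    (hG₀ : ∀ S₀ ∈ admSOfRecord F ν τ.M g p.K k s'.init, Integrable (fun U => w p g k s' U ((avOfRecord F N p.K k).avg U) *
      (chiSeqOfRecord F N ν τ.M g p.K k s'.init U *
        tkBranchOfRecord F N V ν τ.M g p.K W₀ s'.init S₀ k (fun ω => Φ₀ (S₀, fun j => (ω j).2) (fun j => (ω j).1)) (baseCfg k U)))
      (fieldMeasure (F.P p.K) k (SU N)))
    (Fᵢ₀ : (ℕ → Set (Site (F.P p.K) 0)) → (↥(Set.toFinite (bondsIn k (s'.Ω (k + 1))ᶜ)).toFinset → SU N) ×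
        ({c : PBond (F.P p.K) (k + 1) // c ∉ (Set.toFinite (bondsIn (k + 1) (s'.Ω (k + 1))ᶜ)).toFinset} → SU N) → ℝ)
    (hFm₀ : ∀ S₀ ∈ admSOfRecord F ν τ.M g p.K k s'.init, Measurable (Fᵢ₀ S₀))
    (hin₀ : ∀ S₀ ∈ admSOfRecord F ν τ.M g p.K k s'.init, kernelTransport
        ((Measure.pi fun _ : ↥(Set.toFinite (bondsIn k (s'.Ω (k + 1))ᶜ)).toFinset => (HaarData.haar : Measure (SU N))).prod
          (Measure.pi fun _ : {b : PBond (F.P p.K) k // b ∉ (Set.toFinite (bondsIn k (s'.Ω (k + 1))ᶜ)).toFinset} => (HaarData.haar : Measure (SU N))))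
        ((Measure.pi fun _ : ↥(Set.toFinite (bondsIn k (s'.Ω (k + 1))ᶜ)).toFinset => (HaarData.haar : Measure (SU N))).prod
          (Measure.pi fun _ : {c : PBond (F.P p.K) (k + 1) // c ∉ (Set.toFinite (bondsIn (k + 1) (s'.Ω (k + 1))ᶜ)).toFinset} =>
            (HaarData.haar : Measure (SU N))))
        (fun q => (q.1, fun c : {c : PBond (F.P p.K) (k + 1) // c ∉ (Set.toFinite (bondsIn (k + 1) (s'.Ω (k + 1))ᶜ)).toFinset} =>
          (avOfRecord F N p.K k).avg
            ((MeasurableEquiv.piEquivPiSubtypeProd (fun _ : PBond (F.P p.K) k => SU N)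
              (· ∈ (Set.toFinite (bondsIn k (s'.Ω (k + 1))ᶜ)).toFinset)).symm q) c))
        ((fun U => w p g k s' U ((avOfRecord F N p.K k).avg U) *
            (chiSeqOfRecord F N ν τ.M g p.K k s'.init U *
              tkBranchOfRecord F N V ν τ.M g p.K W₀ s'.init S₀ k (fun ω => Φ₀ (S₀, fun j => (ω j).2) (fun j => (ω j).1)) (baseCfg k U))) ∘
          ⇑(MeasurableEquiv.piEquivPiSubtypeProd (fun _ : PBond (F.P p.K) k => SU N)
            (· ∈ (Set.toFinite (bondsIn k (s'.Ω (k + 1))ᶜ)).toFinset)).symm)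
      =ᵐ[((Measure.pi fun _ : ↥(Set.toFinite (bondsIn k (s'.Ω (k + 1))ᶜ)).toFinset => (HaarData.haar : Measure (SU N))).prod
          (Measure.pi fun _ : {c : PBond (F.P p.K) (k + 1) // c ∉ (Set.toFinite (bondsIn (k + 1) (s'.Ω (k + 1))ᶜ)).toFinset} =>
            (HaarData.haar : Measure (SU N))))] Fᵢ₀ S₀)
    (hgm : ∀ S ∈ admSOfRecord F ν τ.M g p.K (k + 1) s', Measurable fun x :
        ((↥(Set.toFinite (bondsIn (k + 1) (s'.Ω (k + 1))ᶜ)).toFinset → SU N) ×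
            ({c : PBond (F.P p.K) (k + 1) // c ∉ (Set.toFinite (bondsIn (k + 1) (s'.Ω (k + 1))ᶜ)).toFinset} → SU N)) ×
          (↥(Set.toFinite (bondsIn k (s'.Ω (k + 1))ᶜ)).toFinset → SU N) =>
      zetaOp (genDataOfRecord F N V ν τ.M g p.K W s' S k).ζ
        (aOp k (genDataOfRecord F N V ν τ.M g p.K W s' S k).sA (genDataOfRecord F N V ν τ.M g p.K W s' S k).w
          (tkBranchOfRecord F N V ν τ.M g p.K W s' S k (fun ω => Φ (S, fun j => (ω j).2) (fun j => (ω j).1))))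
        (Function.update (baseCfg (k + 1) ((MeasurableEquiv.piEquivPiSubtypeProd (fun _ : PBond (F.P p.K) (k + 1) => SU N)
                (· ∈ (Set.toFinite (bondsIn (k + 1) (s'.Ω (k + 1))ᶜ)).toFinset)).symm x.1)) k
          (Function.updateFinset ((baseCfg (V := V) (k + 1) ((MeasurableEquiv.piEquivPiSubtypeProd (fun _ : PBond (F.P p.K) (k + 1) => SU N)
                (· ∈ (Set.toFinite (bondsIn (k + 1) (s'.Ω (k + 1))ᶜ)).toFinset)).symm x.1)) k).1 (Set.toFinite (bondsIn k (s'.Ω (k + 1))ᶜ)).toFinset x.2,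
            ((baseCfg (V := V) (k + 1) ((MeasurableEquiv.piEquivPiSubtypeProd (fun _ : PBond (F.P p.K) (k + 1) => SU N)
                (· ∈ (Set.toFinite (bondsIn (k + 1) (s'.Ω (k + 1))ᶜ)).toFinset)).symm x.1)) k).2)))
    (hW : W.Laws) (hΦ0 : ∀ S ∈ admSOfRecord F ν τ.M g p.K (k + 1) s', ∀ ω : MultiCfg (F.P p.K) (SU N) V, 0 ≤ Φ (S, fun j => (ω j).2) (fun j => (ω j).1))
    (hinner₀ : ∀ᵐ q ∂((Measure.pi fun _ : ↥(Set.toFinite (bondsIn (k + 1) (s'.Ω (k + 1))ᶜ)).toFinset => (HaarData.haar : Measure (SU N))).prod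
          (Measure.pi fun _ : {c : PBond (F.P p.K) (k + 1) // c ∉ (Set.toFinite (bondsIn (k + 1) (s'.Ω (k + 1))ᶜ)).toFinset} =>
            (HaarData.haar : Measure (SU N)))),
      ∀ S₀ ∈ admSOfRecord F ν τ.M g p.K k s'.init, ∀ y : ↥(Set.toFinite (bondsIn k (s'.Ω (k + 1))ᶜ)).toFinset → SU N,
        avgRestrOfRecord F N p.K k (Set.toFinite (bondsIn k (s'.Ω (k + 1))ᶜ)).toFinset (Set.toFinite (bondsIn (k + 1) (s'.Ω (k + 1))ᶜ)).toFinset y = q.1 →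
        Fᵢ₀ S₀ (y, q.2) =
          ∑ Y ∈ (Set.toFinite {Y : Set (Site (F.P p.K) 0) | Y ∈ SClassOfRecord F ν g p.K (k + 1) ∧ Y ⊆ s'.Ω (k + 1) ∩ (s'.Λ (k + 1))ᶜ}).toFinset,
            zetaOp (genDataOfRecord F N V ν τ.M g p.K W s' (Function.update S₀ (k + 1) Y) k).ζ
              (aOp k (genDataOfRecord F N V ν τ.M g p.K W s' (Function.update S₀ (k + 1) Y) k).sA
                (genDataOfRecord F N V ν τ.M g p.K W s' (Function.update S₀ (k + 1) Y) k).w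
                (tkBranchOfRecord F N V ν τ.M g p.K W s'.init S₀ k
                  (fun ω => Φ (Function.update S₀ (k + 1) Y, fun j => (ω j).2) (fun j => (ω j).1))))
              (Function.update (baseCfg (k + 1) ((MeasurableEquiv.piEquivPiSubtypeProd (fun _ : PBond (F.P p.K) (k + 1) => SU N)
                (· ∈ (Set.toFinite (bondsIn (k + 1) (s'.Ω (k + 1))ᶜ)).toFinset)).symm q)) k
              (Function.updateFinset ((baseCfg (V := V) (k + 1) ((MeasurableEquiv.piEquivPiSubtypeProd (fun _ : PBond (F.P p.K) (k + 1) => SU N)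
                (· ∈ (Set.toFinite (bondsIn (k + 1) (s'.Ω (k + 1))ᶜ)).toFinset)).symm q)) k).1 (Set.toFinite (bondsIn k (s'.Ω (k + 1))ᶜ)).toFinset y,
                ((baseCfg (V := V) (k + 1) ((MeasurableEquiv.piEquivPiSubtypeProd (fun _ : PBond (F.P p.K) (k + 1) => SU N)
                (· ∈ (Set.toFinite (bondsIn (k + 1) (s'.Ω (k + 1))ᶜ)).toFinset)).symm q)) k).2))) :
    slotsTOfRecord F N ν τ E w ppSel p g (k + 1) s' =ᵐ[fieldMeasure (F.P p.K) (k + 1) (SU N)] TkOfRecord F N V ν τ.M g p.K W (k + 1) s' Φ := by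
  exact slotsTOfRecord_succ_ae_eq_TkOfRecord_succ_of_innerSum_of_laws ν τ E w ppSel p g hkK (hdec := hdec) (hdec' := hdec') hk s' W Φ
    ((integrable_finsetSum _ hG₀).congr (graph_ae_eq_sum_oldBranch_pieces ν τ E w ppSel p g s' W₀ Φ₀ hform).symm)
    (Finset.measurable_sum _ hFm₀)
    (innerReading_of_oldBranch_pieces ν τ E w ppSel p g (hdec := hdec) (hdec' := hdec') hk s' W₀ Φ₀ hform hG₀ Fᵢ₀ hin₀) hgm hW hΦ0
    (innerSum_of_oldBranch_identifications ν τ p g (hdec := hdec) (hdec' := hdec') s' W Φ Fᵢ₀ hinner₀)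

end Generic

/-! ## §2  Stage-13 letters: the (O3′) DISJUNCTION of `PresentChildObligations` from `HasSect2FormAtZS`, the core provisos, rows and the per-old-branch charted data -/

section Stage13

/-- ★★★★★★ **THE (O3′) DISJUNCTION AT A v1.7 PARAMETER FROM THEOREM 1's LEVEL-`k` FORM, THE CORE PROVISOS, ROWS AND THE PER-OLD-BRANCH CHARTED DATA — `_of_provisos`**: dag-n11-d's
`…OldBranchInnerSumAtRecord13.slotsTOfRecord₁₃H_succ_O3_of_hasSect2FormAtZS_of_oldBranchInnerSum` with `hint` GONE and `hG₀` DISCHARGED.  At `θ : Stage13HParams F N` with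
`h : θ.Provisos₁₃CoPH F N`, run `p`, `k < K`, history `s′` of length `k+1`, a level-`k` witness family `(t, Ek)` with def-T's `HasSect2FormAtZS … k … law … t Ek` (ANY law package) and
ANY proposed `(t′, E′)`: given the measurability of the residuals serving `init s′` and `s′` (`ζ0_j(Y)`, `quad_j(Λ′)`), of the old and new operands on the multiscale configuration
space, and the per-old-branch chart-side data `Fᵢ₀` ∕ `hFm₀` ∕ `hin₀` ∕ `hinner₀`, the last conjunct of `…N11Sect3SupplyChainDefs.PresentChildObligations θ p k t tnew EkN s′` (at
`t′ := graftAboveB k (t s′.init) (tnew s′)`, `E′ := EkN s′`) HOLDS.  Inside: `hG` by `hG_at_record₁₃_of_provisos`, `0 ≤ w` by `zetaOfRecord_nonneg` (`zetaUnity` ∕ `zetaAbs`) +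
`wOfRecord_nonneg`, `w`'s graph section measurable by `Provisos₁₃CoPH.tstep.measW` on the graph of `avOfRecord`, `χ_k` measurable by K0c's `localBgMeasurable`, whence `hG₀`
(p625485 §3); `hgm` by p626903 §2; the weight laws by `WtOfRecord₁₃H_laws h.zhLaws`; the operand positive (`sect2Operand_pos`); then §1.
[cite: Balaban1988Convergent, Thm 1 p.262, Thm 2 p.263, §3 p.279, (3.1) p.264, (3.2)–(3.9) pp.265–266, (3.16) p.268, (3.24)–(3.25) p.270, (2.18) p.257, (2.20)–(2.21) p.258] -/
theorem slotsTOfRecord₁₃H_succ_O3_of_hasSect2FormAtZS_of_oldBranchInnerSum_of_provisos (θ : Stage13HParams F N) (h : θ.Provisos₁₃CoPH F N)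
    (p : B12.RunParams) {k : ℕ} (hkK : k < p.K)
    {hdec : DecidableEq (PBond (F.P p.K) k)} {hdec' : DecidableEq (PBond (F.P p.K) (k + 1))} (hk : k + 1 ≤ (F.P p.K).m + (F.P p.K).K)
    (s' : SeqOfRecord F θ.ν θ.τ9.M (gOfRecord₁₃ F N θ.toStage13Params p) p.K (k + 1))
    {law : SeqOfRecord F θ.ν θ.τ9.M (gOfRecord₁₃ F N θ.toStage13Params p) p.K k → Sect2.TermValues (F.P p.K) (MatA N) (FluctV N) θ.τ9.M → Prop}
    {t : SeqOfRecord F θ.ν θ.τ9.M (gOfRecord₁₃ F N θ.toStage13Params p) p.K k → Sect2.TermValues (F.P p.K) (MatA N) (FluctV N) θ.τ9.M}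
    {Ek : SeqOfRecord F θ.ν θ.τ9.M (gOfRecord₁₃ F N θ.toStage13Params p) p.K k → ℝ}
    (hform : HasSect2FormAtZS F N (FluctV N) p.K (settingOfRecord₁₃ F N θ.toStage13Params p) k (θ.rzAt p) (WtOfRecord₁₃H F N θ p)
      (UbgOfRecord₁₃CoP F N θ.toStage13Params p k) law
      (slotsOfRecord F N θ.ν θ.τ9 (EOfRecord₁₃ F N θ.toStage13Params) (wOfRecord₉ F N θ.toStage9Params) θ.ppSel p (gOfRecord₁₃ F N θ.toStage13Params p) k) t Ek)
    (t' : Sect2.TermValues (F.P p.K) (MatA N) (FluctV N) θ.τ9.M) (E' : ℝ)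
    -- measurability rows of dag-n11-e's `ResidualRowsAt` ∕ `OperandRowsAt` shapes: the residual serving `init s′` and the OLD operand (for `hG₀`) …
    (hζ0m : ∀ j Y, Measurable ((θ.zhAt p s'.init).ζ0 j Y)) (hqm : ∀ j Λ', Measurable ((θ.zhAt p s'.init).quad j Λ'))
    (hΦ₀m : ∀ S₀ ∈ admSOfRecord F θ.ν θ.τ9.M (gOfRecord₁₃ F N θ.toStage13Params p) p.K k s'.init,
      Measurable fun ω : MultiCfg (F.P p.K) (SU N) (FluctV N) =>
        (sect2Operand F N (FluctV N) p.K (settingOfRecord₁₃ F N θ.toStage13Params p) (θ.rzAt p s'.init) s'.init (t s'.init) (Ek s'.init)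
            (UbgOfRecord₁₃CoP F N θ.toStage13Params p k s'.init)) (S₀, fun j => (ω j).2) (fun j => (ω j).1))
    -- … and the residual serving `s′` and the NEW operand (for `hgm`)
    (hζm : ∀ j Y, Measurable ((θ.zhAt p s').ζ0 j Y)) (hqm' : ∀ j Λ', Measurable ((θ.zhAt p s').quad j Λ'))
    (hΦm : ∀ S ∈ admSOfRecord F θ.ν θ.τ9.M (gOfRecord₁₃ F N θ.toStage13Params p) p.K (k + 1) s',
      Measurable fun ω : MultiCfg (F.P p.K) (SU N) (FluctV N) =>
        (sect2Operand F N (FluctV N) p.K (settingOfRecord₁₃ F N θ.toStage13Params p) (θ.rzAt p s') s' t' E'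
            (UbgOfRecord₁₃CoP F N θ.toStage13Params p (k + 1) s')) (S, fun j => (ω j).2) (fun j => (ω j).1))
    (Fᵢ₀ : (ℕ → Set (Site (F.P p.K) 0)) → (↥(Set.toFinite (bondsIn k (s'.Ω (k + 1))ᶜ)).toFinset → SU N) ×
        ({c : PBond (F.P p.K) (k + 1) // c ∉ (Set.toFinite (bondsIn (k + 1) (s'.Ω (k + 1))ᶜ)).toFinset} → SU N) → ℝ)
    (hFm₀ : ∀ S₀ ∈ admSOfRecord F θ.ν θ.τ9.M (gOfRecord₁₃ F N θ.toStage13Params p) p.K k s'.init, Measurable (Fᵢ₀ S₀))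
    (hin₀ : ∀ S₀ ∈ admSOfRecord F θ.ν θ.τ9.M (gOfRecord₁₃ F N θ.toStage13Params p) p.K k s'.init, kernelTransport
        ((Measure.pi fun _ : ↥(Set.toFinite (bondsIn k (s'.Ω (k + 1))ᶜ)).toFinset => (HaarData.haar : Measure (SU N))).prod
          (Measure.pi fun _ : {b : PBond (F.P p.K) k // b ∉ (Set.toFinite (bondsIn k (s'.Ω (k + 1))ᶜ)).toFinset} => (HaarData.haar : Measure (SU N))))
        ((Measure.pi fun _ : ↥(Set.toFinite (bondsIn k (s'.Ω (k + 1))ᶜ)).toFinset => (HaarData.haar : Measure (SU N))).prod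
          (Measure.pi fun _ : {c : PBond (F.P p.K) (k + 1) // c ∉ (Set.toFinite (bondsIn (k + 1) (s'.Ω (k + 1))ᶜ)).toFinset} =>
            (HaarData.haar : Measure (SU N))))
        (fun q => (q.1, fun c : {c : PBond (F.P p.K) (k + 1) // c ∉ (Set.toFinite (bondsIn (k + 1) (s'.Ω (k + 1))ᶜ)).toFinset} =>
          (avOfRecord F N p.K k).avg
            ((MeasurableEquiv.piEquivPiSubtypeProd (fun _ : PBond (F.P p.K) k => SU N)
              (· ∈ (Set.toFinite (bondsIn k (s'.Ω (k + 1))ᶜ)).toFinset)).symm q) c))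
        ((fun U => wOfRecord₉ F N θ.toStage9Params p (gOfRecord₁₃ F N θ.toStage13Params p) k s' U ((avOfRecord F N p.K k).avg U) *
            (chiSeqOfRecord F N θ.ν θ.τ9.M (gOfRecord₁₃ F N θ.toStage13Params p) p.K k s'.init U *
              tkBranchOfRecord F N (FluctV N) θ.ν θ.τ9.M (gOfRecord₁₃ F N θ.toStage13Params p) p.K (WtOfRecord₁₃H F N θ p s'.init) s'.init S₀ k
                (fun ω => (sect2Operand F N (FluctV N) p.K (settingOfRecord₁₃ F N θ.toStage13Params p) (θ.rzAt p s'.init) s'.init (t s'.init) (Ek s'.init)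
            (UbgOfRecord₁₃CoP F N θ.toStage13Params p k s'.init)) (S₀, fun j => (ω j).2) (fun j => (ω j).1)) (baseCfg k U))) ∘
          ⇑(MeasurableEquiv.piEquivPiSubtypeProd (fun _ : PBond (F.P p.K) k => SU N)
            (· ∈ (Set.toFinite (bondsIn k (s'.Ω (k + 1))ᶜ)).toFinset)).symm)
      =ᵐ[((Measure.pi fun _ : ↥(Set.toFinite (bondsIn k (s'.Ω (k + 1))ᶜ)).toFinset => (HaarData.haar : Measure (SU N))).prod
          (Measure.pi fun _ : {c : PBond (F.P p.K) (k + 1) // c ∉ (Set.toFinite (bondsIn (k + 1) (s'.Ω (k + 1))ᶜ)).toFinset} =>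
            (HaarData.haar : Measure (SU N))))] Fᵢ₀ S₀)
    (hinner₀ : ∀ᵐ q ∂((Measure.pi fun _ : ↥(Set.toFinite (bondsIn (k + 1) (s'.Ω (k + 1))ᶜ)).toFinset => (HaarData.haar : Measure (SU N))).prod
          (Measure.pi fun _ : {c : PBond (F.P p.K) (k + 1) // c ∉ (Set.toFinite (bondsIn (k + 1) (s'.Ω (k + 1))ᶜ)).toFinset} =>
            (HaarData.haar : Measure (SU N)))),
      ∀ S₀ ∈ admSOfRecord F θ.ν θ.τ9.M (gOfRecord₁₃ F N θ.toStage13Params p) p.K k s'.init, ∀ y : ↥(Set.toFinite (bondsIn k (s'.Ω (k + 1))ᶜ)).toFinset → SU N,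
        avgRestrOfRecord F N p.K k (Set.toFinite (bondsIn k (s'.Ω (k + 1))ᶜ)).toFinset (Set.toFinite (bondsIn (k + 1) (s'.Ω (k + 1))ᶜ)).toFinset y = q.1 →
        Fᵢ₀ S₀ (y, q.2) =
          ∑ Y ∈ (Set.toFinite {Y : Set (Site (F.P p.K) 0) | Y ∈ SClassOfRecord F θ.ν (gOfRecord₁₃ F N θ.toStage13Params p) p.K (k + 1) ∧ Y ⊆ s'.Ω (k + 1) ∩ (s'.Λ (k + 1))ᶜ}).toFinset,
            zetaOp (genDataOfRecord F N (FluctV N) θ.ν θ.τ9.M (gOfRecord₁₃ F N θ.toStage13Params p) p.K (WtOfRecord₁₃H F N θ p s') s' (Function.update S₀ (k + 1) Y) k).ζ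
              (aOp k (genDataOfRecord F N (FluctV N) θ.ν θ.τ9.M (gOfRecord₁₃ F N θ.toStage13Params p) p.K (WtOfRecord₁₃H F N θ p s') s' (Function.update S₀ (k + 1) Y) k).sA
                (genDataOfRecord F N (FluctV N) θ.ν θ.τ9.M (gOfRecord₁₃ F N θ.toStage13Params p) p.K (WtOfRecord₁₃H F N θ p s') s' (Function.update S₀ (k + 1) Y) k).w
                (tkBranchOfRecord F N (FluctV N) θ.ν θ.τ9.M (gOfRecord₁₃ F N θ.toStage13Params p) p.K (WtOfRecord₁₃H F N θ p s') s'.init S₀ k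
                  (fun ω => (sect2Operand F N (FluctV N) p.K (settingOfRecord₁₃ F N θ.toStage13Params p) (θ.rzAt p s') s' t' E'
                  (UbgOfRecord₁₃CoP F N θ.toStage13Params p (k + 1) s')) (Function.update S₀ (k + 1) Y, fun j => (ω j).2) (fun j => (ω j).1))))
              (Function.update (baseCfg (k + 1) ((MeasurableEquiv.piEquivPiSubtypeProd (fun _ : PBond (F.P p.K) (k + 1) => SU N)
                (· ∈ (Set.toFinite (bondsIn (k + 1) (s'.Ω (k + 1))ᶜ)).toFinset)).symm q)) k
              (Function.updateFinset ((baseCfg (V := FluctV N) (k + 1) ((MeasurableEquiv.piEquivPiSubtypeProd (fun _ : PBond (F.P p.K) (k + 1) => SU N)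
                (· ∈ (Set.toFinite (bondsIn (k + 1) (s'.Ω (k + 1))ᶜ)).toFinset)).symm q)) k).1 (Set.toFinite (bondsIn k (s'.Ω (k + 1))ᶜ)).toFinset y,
                ((baseCfg (V := FluctV N) (k + 1) ((MeasurableEquiv.piEquivPiSubtypeProd (fun _ : PBond (F.P p.K) (k + 1) => SU N)
                (· ∈ (Set.toFinite (bondsIn (k + 1) (s'.Ω (k + 1))ᶜ)).toFinset)).symm q)) k).2))) :
    slotsTOfRecord F N θ.ν θ.τ9 (EOfRecord₁₃ F N θ.toStage13Params) (wOfRecord₉ F N θ.toStage9Params) θ.ppSel p (gOfRecord₁₃ F N θ.toStage13Params p) (k + 1) s' = 0 ∨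
      ∀ᵐ V' ∂fieldMeasure (F.P p.K) (k + 1) (SU N),
        chiSeqOfRecord F N θ.ν θ.τ9.M (gOfRecord₁₃ F N θ.toStage13Params p) p.K (k + 1) s' V' ≠ 0 →
          slotsTOfRecord F N θ.ν θ.τ9 (EOfRecord₁₃ F N θ.toStage13Params) (wOfRecord₉ F N θ.toStage9Params) θ.ppSel p (gOfRecord₁₃ F N θ.toStage13Params p) (k + 1) s' V' =
            sect2Slot F N (FluctV N) p.K (settingOfRecord₁₃ F N θ.toStage13Params p) (θ.rzAt p s') (WtOfRecord₁₃H F N θ p s') s' t' E'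
              (UbgOfRecord₁₃CoP F N θ.toStage13Params p (k + 1) s') V' := by
  rcases (hform.2 s'.init).2 with h0 | hae
  · exact Or.inl (slotsTOfRecord_succ_eq_zero_of_init_eq_zero F N θ.ν θ.τ9 _ _ θ.ppSel p _ _ s' h0)
  · -- the rows `hG`, `0 ≤ w`, measurability of `w`'s graph section and of `χ_k` are THEOREMS of the core provisos
    have hG := hG_at_record₁₃_of_provisos θ h p hkK s'
    have hζ0 := zetaOfRecord_nonneg F N θ.ν θ.τ9.M h.zetaUnity h.zetaAbs
    have hw0 : ∀ U, 0 ≤ wOfRecord₉ F N θ.toStage9Params p (gOfRecord₁₃ F N θ.toStage13Params p) k s' U ((avOfRecord F N p.K k).avg U) :=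
      fun U => wOfRecord_nonneg F N θ.ν θ.τ9.M p _ k θ.A₁ hζ0 s' U _
    have hW2 := (h.tstep p k hkK).measW s'
    have hgr : Measurable fun U : GaugeField (F.P p.K) k (SU N) => ((avOfRecord F N p.K k).avg U, U) :=
      (avOfRecord_measurable F N p.K k).prodMk measurable_id
    have hwm : Measurable fun U => wOfRecord₉ F N θ.toStage9Params p (gOfRecord₁₃ F N θ.toStage13Params p) k s' U ((avOfRecord F N p.K k).avg U) := by
      have h' := hW2.comp hgr  -- elaborated WITHOUT the expected type (else the unifier unfolds `wOfRecord`'s label sum)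
      exact h'
    have hχm : Measurable fun U => chiSeqOfRecord F N θ.ν θ.τ9.M (gOfRecord₁₃ F N θ.toStage13Params p) p.K k s'.init U :=
      measurable_chiSeqOfRecord_of_localBg (localBgMeasurable F N θ.ν) θ.τ9.M _ p.K k s'.init
    have hG₀ := integrable_oldBranch_pieces₁₃H_of_integrable_graph θ p s' t Ek hG hae h.zhLaws hw0 hwm hχm hζ0m hqm hΦ₀m
    exact Or.inr ((slotsTOfRecord_succ_ae_eq_TkOfRecord_succ_of_oldBranchInnerSum_of_laws θ.ν θ.τ9 (EOfRecord₁₃ F N θ.toStage13Params)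
      (wOfRecord₉ F N θ.toStage9Params) θ.ppSel p (gOfRecord₁₃ F N θ.toStage13Params p) hkK (hdec := hdec) (hdec' := hdec') hk s' (WtOfRecord₁₃H F N θ p s'.init) (WtOfRecord₁₃H F N θ p s')
      (sect2Operand F N (FluctV N) p.K (settingOfRecord₁₃ F N θ.toStage13Params p) (θ.rzAt p s'.init) s'.init (t s'.init) (Ek s'.init)
            (UbgOfRecord₁₃CoP F N θ.toStage13Params p k s'.init))
      (sect2Operand F N (FluctV N) p.K (settingOfRecord₁₃ F N θ.toStage13Params p) (θ.rzAt p s') s' t' E'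
                  (UbgOfRecord₁₃CoP F N θ.toStage13Params p (k + 1) s'))
      hae hG₀ Fᵢ₀ hFm₀ hin₀ (hgm_at_record₁₃_of_rows θ p (hdec := hdec) (hdec' := hdec') s' t' E' hζm hqm' hΦm) (WtOfRecord₁₃H_laws h.zhLaws p s')
      (fun S _ ω => (sect2Operand_pos p.K _ _ s' t' E' _ (S, fun j => (ω j).2) (fun j => (ω j).1)).le) hinner₀).mono fun _ hV' _ => hV')

end Stage13

end Summit.QuantumFields.YangMills.Theorems.BalabanUVNodesN11TStepOldBranchInnerSumOfProvisos

end
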